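import Mathlib
import Literature.NumberTheory.Transcendental.KZCalculusProofs
import Summits.KontsevichZagierPeriods.KontsevichZagierPeriods.Theorems.SoloInformedRealParamKernelI
import HarnessLib

/-!
# Solo-informed (A393): THEOREM T for arbitrary FORMAL COMBINATIONS — `P_ℚ ↪ P_ℝ`

File F6l.  **Injectivity of base change on formal effective periods.** The transfer theorem
`soloInformed_realParameterTransferI` / `soloInformed_realParameterTransfer_prep` (file F6f / F6k)
is stated for PAIRS of `ℚ`-representations: a `KZ_ℝ`-relation `[r ⊗ ℝ] − [r' ⊗ ℝ] ∈ relations ℝ`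
is already a `KZ_ℚ`-relation. Here it is upgraded to ARBITRARY formal `ℤ`-combinations
`q : KZOver.FormalRep ℚ`: `baseChange ℚ ℝ q ∈ relations ℝ ↔ q ∈ relations ℚ`
(`soloInformed_baseChange_mem_relations_iffI`, conditional on definability of the generators of
`KZ_ℝ`; `soloInformed_baseChange_mem_relations_iff_prep`, conditional on the preparation fact
`semialgebraicPreparation`). Equivalently the induced map of formal effective period groups
`FormalRep ℚ ⧸ relations ℚ → FormalRep ℝ ⧸ relations ℝ` is injective
(`soloInformed_comap_baseChange_relations_prep`: `(relations ℝ).comap (baseChange ℚ ℝ) =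
relations ℚ`), and for Kontsevich–Zagier's own formal group `KZ.FormalRep` a combination becomes
a `KZ_ℝ`-relation after base change iff it is a KZ-relation
(`soloInformed_kz_baseChange_mem_relations_iff_prep`).

The reduction to pairs is Kontsevich–Zagier's bookkeeping normal form
`KZ.exists_integralRep_sub_holds` (every formal combination is `≡ [r] − [r']` modulo the moves),
transported along `KZOver.equivKZ : KZ.FormalRep ≃+ KZOver.FormalRep ℚ`, plus functoriality of
base change on relations (`KZOver.baseChange_mem_relations`).

References: [cite: KontsevichZagier2001, §1.2]; [cite: BochnakCosteRoy1998, Prop. 2.2.4, 5.2.3].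
-/

noncomputable section

open Set Literature.ModelTheory.ExponentialFields Literature.NumberTheory.Transcendental

namespace Summit.KontsevichZagierPeriods.KontsevichZagierPeriods.Theorems

/-- **Two-representation normal form over `ℚ`.** Every formal `ℤ`-combination of integral
representations with coefficients in `ℚ` is, modulo the moves, a difference `[r] − [r']`
(Kontsevich–Zagier's bookkeeping `KZ.exists_integralRep_sub_holds`, transported along
`KZOver.equivKZ`). [cite: KontsevichZagier2001, §1.2] -/
theorem soloInformed_exists_of_sub_of_rat (q : KZOver.FormalRep ℚ) :
    ∃ (n m : ℕ) (r : KZOver.IntegralRep ℚ n) (r' : KZOver.IntegralRep ℚ m),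
      q - (KZOver.of r - KZOver.of r') ∈ KZOver.relations ℚ := by
  obtain ⟨n, m, r, r', h⟩ := KZ.exists_integralRep_sub_holds (KZOver.equivKZ.symm q)
  refine ⟨n, m, KZOver.IntegralRep.ofKZ r, KZOver.IntegralRep.ofKZ r', ?_⟩
  have h' := (KZOver.equivKZ_mem_relations_iff _).mpr h
  simpa only [map_sub, AddEquiv.apply_symm_apply, KZOver.equivKZ_of] using h'

/-- **THEOREM T (arbitrary formal combinations; `P_ℚ ↪ P_ℝ`).** Conditional on definability of
the generators of `KZ_ℝ`: a formal `ℤ`-combination of `ℚ`-representations whose base change to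
`ℝ` is a `KZ_ℝ`-relation (a chain of the four Kontsevich–Zagier moves with REAL semialgebraic
data) is already a `KZ_ℚ`-relation; the converse is functoriality of base change. Reduction to the
pair case `soloInformed_realParameterTransferI` by the two-representation normal form.
[cite: KontsevichZagier2001, §1.2, Conjecture 1] -/
theorem soloInformed_baseChange_mem_relations_iffI
    (hgen : ∀ c ∈ soloInformedGenerators ℝ, SoloInformedDefinableRelI c)
    (q : KZOver.FormalRep ℚ) :
    KZOver.baseChange ℚ ℝ q ∈ KZOver.relations ℝ ↔ q ∈ KZOver.relations ℚ := by
  refine ⟨fun hq => ?_, fun hq => KZOver.baseChange_mem_relations ℝ hq⟩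
  obtain ⟨n, m, r, r', hnf⟩ := soloInformed_exists_of_sub_of_rat q
  -- base change of the normal form: `q ⊗ ℝ − ([r ⊗ ℝ] − [r' ⊗ ℝ]) ∈ relations ℝ`
  have hbc : KZOver.baseChange ℚ ℝ q -
      (KZOver.of (r.baseChange ℝ) - KZOver.of (r'.baseChange ℝ)) ∈ KZOver.relations ℝ := by
    simpa only [map_sub, KZOver.baseChange_of] using KZOver.baseChange_mem_relations ℝ hnf
  -- hence the pair `[r ⊗ ℝ] − [r' ⊗ ℝ]` is a `KZ_ℝ`-relation
  have hpair : KZOver.of (r.baseChange ℝ) - KZOver.of (r'.baseChange ℝ) ∈ KZOver.relations ℝ := by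
    have := (KZOver.relations ℝ).sub_mem hq hbc
    rwa [sub_sub_cancel] at this
  -- transfer the pair, then reassemble `q = (q − ([r] − [r'])) + ([r] − [r'])`
  have hT := soloInformed_realParameterTransferI hgen r r' hpair
  have := (KZOver.relations ℚ).add_mem hnf hT
  rwa [sub_add_cancel] at this

/-- **THEOREM T (arbitrary formal combinations), conditional on the preparation fact**:
`baseChange ℚ ℝ q ∈ relations ℝ ↔ q ∈ relations ℚ` for every `q : KZOver.FormalRep ℚ` — real
semialgebraic parameters in the moves prove no new `ℤ`-linear relation between periods with
rational representations. [cite: KontsevichZagier2001, §1.2, Conjecture 1] -/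
theorem soloInformed_baseChange_mem_relations_iff_prep (hprep : semialgebraicPreparation)
    (q : KZOver.FormalRep ℚ) :
    KZOver.baseChange ℚ ℝ q ∈ KZOver.relations ℝ ↔ q ∈ KZOver.relations ℚ :=
  soloInformed_baseChange_mem_relations_iffI (soloInformed_definableRelI_generators hprep) q

/-- **`P_ℚ ↪ P_ℝ` (subgroup form)**, conditional on the preparation fact: the pull-back of the
`KZ_ℝ`-relations along base change is exactly the `KZ_ℚ`-relations, i.e. the induced homomorphism
of formal effective period groups `FormalRep ℚ ⧸ relations ℚ → FormalRep ℝ ⧸ relations ℝ` is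
injective. [cite: KontsevichZagier2001, §1.2] -/
theorem soloInformed_comap_baseChange_relations_prep (hprep : semialgebraicPreparation) :
    (KZOver.relations ℝ).comap (KZOver.baseChange ℚ ℝ) = KZOver.relations ℚ := by
  ext q
  rw [AddSubgroup.mem_comap]
  exact soloInformed_baseChange_mem_relations_iff_prep hprep q

/-- **Injectivity on the quotient**, conditional on the preparation fact: the homomorphism of
formal effective period groups `FormalRep ℚ ⧸ relations ℚ → FormalRep ℝ ⧸ relations ℝ` induced by
base change is injective. [cite: KontsevichZagier2001, §1.2] -/
theorem soloInformed_quotientMap_baseChange_injective_prep (hprep : semialgebraicPreparation) :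
    Function.Injective
      (QuotientAddGroup.map (KZOver.relations ℚ) (KZOver.relations ℝ) (KZOver.baseChange ℚ ℝ)
        fun _ hq => KZOver.baseChange_mem_relations ℝ hq) := by
  rw [← AddMonoidHom.ker_eq_bot_iff, eq_bot_iff]
  intro x hx
  induction x using QuotientAddGroup.induction_on with
  | H q =>
    rw [AddMonoidHom.mem_ker, QuotientAddGroup.map_mk, QuotientAddGroup.eq_zero_iff] at hx
    rw [AddSubgroup.mem_bot, QuotientAddGroup.eq_zero_iff]
    exact (soloInformed_baseChange_mem_relations_iff_prep hprep q).mp hx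

/-- **THEOREM T on Kontsevich–Zagier's own formal group**, conditional on the preparation fact:
a formal `ℤ`-combination `c : KZ.FormalRep` of KZ's integral representations becomes a
`KZ_ℝ`-relation after base change to `ℝ` iff it is a KZ-relation — the relation module of the
conjecture is unchanged by admitting real-semialgebraic data in the moves.
[cite: KontsevichZagier2001, §1.2, Conjecture 1] -/
theorem soloInformed_kz_baseChange_mem_relations_iff_prep (hprep : semialgebraicPreparation)
    (c : KZ.FormalRep) :
    KZOver.baseChange ℚ ℝ (KZOver.equivKZ c) ∈ KZOver.relations ℝ ↔ c ∈ KZ.relations := by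
  rw [soloInformed_baseChange_mem_relations_iff_prep hprep, KZOver.equivKZ_mem_relations_iff]

end Summit.KontsevichZagierPeriods.KontsevichZagierPeriods.Theorems
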